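import Summits.Langlands.Langlands.Theorems.PhaseTwistSplitPrelude
import Summits.Langlands.Langlands.Theses.PerfectLayerClifford

/-!
# `PhaseTwistSplit` — lens-4 («minimal counterexample / extremal reduction») g30 node, landing part 2/2 (kernel); part 1 = `PhaseTwistSplitPrelude`

«THE LAYER IS A PHASE.»

TARGET (BY NAME) = RIGID = `Summit.Langlands.Langlands.Theorems.TatePhantomLift.PerfectLayerRigidity` (sha12 `6f5d782b2b84`) = THE LIVE LEDGER
ITEM stmt-Langlands-27355 `Summit.Langlands.Langlands.Theses.PerfectLayerClifford.PerfectLayerRigidity` (crux r3 of route-Langlands-PerfectLayerClifford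
rev 0, born 2026-08-31T12:44Z in thaw slot 4, DRAFT · tribunal pending; identical text, `rigid_item_iff : _ ↔ _ := Iff.rfl`; the route refines
`GaloisHullLift.PerfectHullDescent` = stmt-Langlands-28225), the PARENT of this lineage's declared residual
AUT = `TwinRigiditySplit.CandidateAutomorphy` (sha12 `f13f8e4188e1`, tree twin p822419, tagged IDEA-NEEDED since g29): AUT follows from RIGID BY
NAME (tree `TwinRigiditySplit.aut_of_rigid`), so every decomposition of RIGID is one of AUT (`closes_residual`).  BLOCKER FIRST.

EXTREMAL READING.  A minimal counterexample to RIGID is a triple (π, L, ρ₀): an L-algebraic cuspidal `π` of `GL_n/K`, a Galois layer `L/K`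
without cyclic sub-layers of prime degree, and a semisimple CANDIDATE `ρ₀ : Γ_K → GL_n(ℚ̄_ℓ)` whose restriction to `Γ_L` is the (irreducible)
relative avatar of `π` — yet no avatar of `π` over `K` exists.  Minimise the DATUM, not the group: what does `ρ₀` actually remember of `L`?
Exactly one integer.  At a place `v` of `K` unramified in `L`, `Frob_w = Frob_v^{f(w|v)}` and `f(w|v) ∣ e := [L:K]`, so the relative-avatar
condition along `L` implies (kernel lemma `powCompatible_of_relAvatar`, 0 sorry) the LAYER-FREE condition

  (POW_e)   charpoly ρ₀(Frob_v^e) = ∏_{a ∈ α_v} (X − ι⁻¹(a⁻¹)^e)   for almost all v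

— `ρ₀` is an «e-POWER AVATAR» of `π` over `K`: its Frobenius eigenvalues agree with the predicted ones UP TO e-th ROOTS OF UNITY, eigenvalue by
eigenvalue, prime by prime.  The layer has become a PHASE.  The minimal counterexample is therefore a strongly irreducible Galois representation
that is «automorphic up to an incoherent phase»; the thesis of this node is that phases of strongly irreducible representations are COHERENT:

  PAR (`PowerAvatarDescent`): a semisimple `ρ₀` over `K` that stays irreducible on every finite layer and is an e-power avatar of the
  L-algebraic cuspidal `π` (some `e ≥ 1`) is, after a twist by a character `χ` of `Γ_K` (a «phase»; of finite order under S), an honest avatar of `π` a.e.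

PAR never mentions `L`, `r`, solvability or perfectness: the Galois datum is GIVEN and only its automorphic phase is unknown.  On the cell of
RIGID where the candidate is strongly irreducible, PAR gives RIGID at once (`strong_of_par`: the twisted candidate `ρ₀ ⊗ χ` is the avatar;
semisimplicity of twists is the tree's `isSemisimple_twist`); the complementary cell — candidates that become REDUCIBLE on some finite layer
(imprimitive / potentially isotypic `r`, every constituent of rank `< n`) — is kept verbatim as the restriction IMP of RIGID.

PIECES (2 + 1 companion; ≤ 15):
* PAR  `PowerAvatarDescent`            — NEW · LATERAL (layer-free reformulation; not a syntactic weakening of RIGID) · S-implied MODULO the print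
  fact [Patankar–Rajan, arXiv:1010.5393, Thm 2 + Cor 1] («locally potentially equivalent at a set of places of density > 1 − 1/c ⟹ potentially
  equivalent») composed with Schur–Clifford (tree `FramedGaloisRep.exists_twist_of_conj_restrictField`) and (A) for `π` — KERNEL-CHECKED as
  `par_of_langlands : PowerCharpolyPotentialEquivalence → Langlands → PAR` (the print fact typed verbatim as a node-local junction binder, §3b) · UNDECIDED: in the regular-algebraic regime it is DECIDED by the same argument from
  the known avatars; in the irregular regime it is (A)-hard like every statement producing an avatar · its automorphic shadow («cusp forms on GL_n
  with the same e-th power Satake parameters differ by a twist») is a theorem for n = 2, e = 2 even for Maass forms [Ramakrishnan 2000, Ann. Math.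
  152, multiplicity one for SL(2)] = a regime where S is open · INSTRUMENTABLE (e-power twin hunt, census instrument I-g30.1).
* IMP  `ImprimitiveCandidateRigidity`  — WEAKER (restriction of RIGID to candidates reducible on some finite layer; `imp_of_rigid`) · S-implied
  (`imp_of_langlands`) · UNDECIDED · rank-reducing cell (every constituent of `ρ₀|Γ_M` has rank < n: the natural input is reciprocity in lower
  rank + automorphic induction, cf. the host's sibling RSELF 28226).
* STRONG `StrongCandidateRigidity` (COMPANION, exactness only) — RIGID restricted to strongly irreducible candidates; RIGID ⟺ STRONG ∧ IMP
  (`rigid_iff_strong_imp`, by cases) and PAR ⟹ STRONG (`strong_of_par`).  Not a piece of the cut; recorded so that the cut's only non-invertible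
  edge (PAR ⟹ STRONG) is explicit.

KERNEL (0 sorry): `closes_target : PAR → IMP → RIGID` (BY NAME; the node's bare `closes` is not re-declared in the tree — registry-owned name), `closes_item : PAR → IMP → Theses.PerfectLayerClifford.PerfectLayerRigidity` (THE ITEM
27355 BY NAME), `closes_route` (PAR ∧ IMP replace the binder RIGID of the route's own deciding theorem: EXT → PAR → IMP → FINTYPE → RED° → RPERF),
`closes_residual : PAR → IMP → AUT` (BY NAME, via `aut_of_rigid`),
`closes_exact`/`rigid_iff_strong_imp`, `imp_of_rigid`, `strong_of_rigid`, `imp_of_langlands`, `strong_of_langlands`, `par_of_langlands`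
(S ∧ [PR] ⟹ PAR), the dictionary `powCompatible_of_relAvatar` (relative avatar along a Galois layer ⟹ [L:K]-power avatar over K; Neukirch I §9 +
`f(w|v) ∣ [L:K]`) and its converse companion `charpoly_pow_of_hasFrobCharpolyAt` (an avatar is an e-power avatar for every e), and the host edges
`closes_host` (RPERF 28225 BY NAME with FINTYPE, RED°, W1, SCHT), `closes_parent` (ANAB 27861), `closes_grandparent` (AvatarDescent 29149).

WHY EACH PIECE IS STRICTLY WEAKER THAN S.  IMP and STRONG are restrictions of RIGID, which is S-implied (`rigid_of_langlands`) and two floors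
below the (A)-half of one conjunct of S; PAR is S-implied modulo [Patankar–Rajan 2010, Thm 2] IN THE KERNEL (`par_of_langlands`) and says
nothing about direction (B) nor about `π` without a power avatar.  None implies S or RIGID by a cheap probe (probes file).

WHY NOVEL (by construction, relative to every node on the bus).  All earlier cuts of this lineage DESCEND ALONG THE LAYER (peel cyclic steps g23,
perfect hull g24/g25, phantom-twist / Schur class g26–g28, automorphic twin ALR g29); lens-1 works on Brauer–Taylor potential descent (33718),
lens-2 on Zarhin/Clifford–Tate proof twins, lens-3 on Iwahori level confinement, lens-5 on depth/monodromy isolation and the R1 ladder, lens-6 on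
spread–decay carving.  Here the layer variable is ELIMINATED: the only trace of `L` is the exponent `e`, and the residual difficulty is restated
as coherence of a root-of-unity phase of a GIVEN Galois representation — a statement with a decided automorphic shadow and a print Galois
neighbour (recovering representations from tensor powers: Rajan 1998/2004, Patankar–Rajan 2010), neither of which occurs in any bus node or in the
negatives index (`ledger negatives`: no power/phase statement among the 3 Langlands negatives).
-/


set_option linter.dupNamespace false
set_option linter.style.longLine false

noncomputable section

namespace Summit.Langlands.Langlands.Theorems.PhaseTwistSplit

open scoped BigOperators Topology Matrix Classical NumberField Polynomial
open Filter Set Function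
open Polynomial (X C)
open Literature.NumberTheory.GaloisRepresentations Literature.NumberTheory.Automorphic
open IsDedekindDomain
open Summit.Langlands.Langlands.Theses
open Summit.Langlands.Langlands.Theses.GaloisHullLift
open Summit.Langlands.Langlands.Theorems.TatePhantomLift
open Summit.Langlands.Langlands.Theorems.TwinRigiditySplit

/-! ## §3 Kernel: `closes` (RIGID BY NAME), `closes_residual` (AUT BY NAME), exactness, S-implied edges (0 sorry) -/

/-- **PAR ⟹ STRONG**: on a strongly irreducible candidate the dictionary makes `ρ₀` an `[L:K]`-power avatar, PAR twists it into an avatar,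
and twists of semisimple representations are semisimple (tree `isSemisimple_twist`).  Irreducibility of `r` and perfectness of the layer are
not used on this cell. -/
theorem strong_of_par (hP : PowerAvatarDescent) : StrongCandidateRigidity := by
  intro K _ _ n hcpt hn π hπ L _ _ _ hGal h1 hnc ℓ _ ι r hr hirr hcand hrel
  obtain ⟨ρ₀, hρ₀, hstrong, h₀⟩ := hcand
  haveI := hGal
  obtain ⟨χ, hχ⟩ := hP K n hcpt hn π hπ ℓ ι ρ₀ hρ₀ hstrong (Module.finrank K L) finrank_pos'
    (powCompatible_of_relAvatar π.1 ι ρ₀ h₀)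
  exact ⟨FramedRep.twist ρ₀ χ, isSemisimple_twist ρ₀ hρ₀ χ, hχ⟩

/-- **RIGID ⟸ STRONG ∧ IMP** (cases on strong irreducibility of the candidate). -/
theorem closes_exact (hS : StrongCandidateRigidity) (hI : ImprimitiveCandidateRigidity) : PerfectLayerRigidity := by
  intro K _ _ n hcpt hn π hπ L _ _ _ hGal h1 hnc ℓ _ ι r hr hirr hcand hrel
  obtain ⟨ρ₀, hρ₀, h₀⟩ := hcand
  by_cases hstrong : ∀ (M : Type) [Field M] [NumberField M] [Algebra K M], (ρ₀.restrictField M).IsIrreducible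
  · exact hS K n hcpt hn π hπ L hGal h1 hnc ℓ ι r hr hirr ⟨ρ₀, hρ₀, hstrong, h₀⟩ hrel
  · exact hI K n hcpt hn π hπ L hGal h1 hnc ℓ ι r hr hirr ⟨ρ₀, hρ₀, hstrong, h₀⟩ hrel

/-- STRONG is a restriction of RIGID. -/
theorem strong_of_rigid (hR : PerfectLayerRigidity) : StrongCandidateRigidity := by
  intro K _ _ n hcpt hn π hπ L _ _ _ hGal h1 hnc ℓ _ ι r hr hirr hcand hrel
  obtain ⟨ρ₀, hρ₀, -, h₀⟩ := hcand
  exact hR K n hcpt hn π hπ L hGal h1 hnc ℓ ι r hr hirr ⟨ρ₀, hρ₀, h₀⟩ hrel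

/-- IMP is a restriction of RIGID. -/
theorem imp_of_rigid (hR : PerfectLayerRigidity) : ImprimitiveCandidateRigidity := by
  intro K _ _ n hcpt hn π hπ L _ _ _ hGal h1 hnc ℓ _ ι r hr hirr hcand hrel
  obtain ⟨ρ₀, hρ₀, -, h₀⟩ := hcand
  exact hR K n hcpt hn π hπ L hGal h1 hnc ℓ ι r hr hirr ⟨ρ₀, hρ₀, h₀⟩ hrel

/-- **Exactness of the companion split**: `RIGID ⟺ STRONG ∧ IMP`. -/
theorem rigid_iff_strong_imp : PerfectLayerRigidity ↔ (StrongCandidateRigidity ∧ ImprimitiveCandidateRigidity) :=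
  ⟨fun hR => ⟨strong_of_rigid hR, imp_of_rigid hR⟩, fun h => closes_exact h.1 h.2⟩

/-- **`closes_target` — THE TARGET BY NAME: RIGID ⟸ PAR ∧ IMP** (the node's bare `closes`; not re-declared in the tree — registry-owned name). -/
theorem closes_target (hP : PowerAvatarDescent) (hI : ImprimitiveCandidateRigidity) : PerfectLayerRigidity :=
  closes_exact (strong_of_par hP) hI

/-- **`closes_residual` — the lineage's DECLARED RESIDUAL BY NAME: AUT ⟸ PAR ∧ IMP** (tree `aut_of_rigid`). -/
theorem closes_residual (hP : PowerAvatarDescent) (hI : ImprimitiveCandidateRigidity) : TwinRigiditySplit.CandidateAutomorphy :=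
  aut_of_rigid (closes_target hP hI)

/-- IMP is S-implied. -/
theorem imp_of_langlands (hL : _root_.Langlands) : ImprimitiveCandidateRigidity := imp_of_rigid (rigid_of_langlands hL)
/-- STRONG is S-implied. -/
theorem strong_of_langlands (hL : _root_.Langlands) : StrongCandidateRigidity := strong_of_rigid (rigid_of_langlands hL)
/-- IMP is implied by the host item RPERF (stmt-Langlands-28225). -/
theorem imp_of_perfect (hP : GaloisHullLift.PerfectHullDescent) : ImprimitiveCandidateRigidity := imp_of_rigid (rigid_of_perfect hP)

/-! ## §3b PAR is S-implied MODULO one print fact (kernel-checked junction; 0 sorry) -/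

/-- **PR · NAMED PRINT FACT, node-local junction binder (NOT a piece; never staffed)** — Patankar–Rajan, *Locally potentially equivalent Galois
representations* (arXiv:1010.5393, J. Ramanujan Math. Soc. 2012), Thm 2, in the special case «T ⊇ all but finitely many places, one exponent `m`»:
two semisimple `ℓ`-adic representations of `Γ_K` whose `m`-th Frobenius powers have the same characteristic polynomial at almost every place are
isomorphic on `Γ_M` for some finite Galois `M/K`.  (Their proof, §2.2, uses exactly `Tr ρ₁(σ_v^m) = Tr ρ₂(σ_v^m)` on `T`: the subvariety
`X_m = {Tr g₁^m = Tr g₂^m}` contains the connected monodromy component by the algebraic Chebotarev theorem of Rajan 1998 [Ra1, Thm 3]; `ℚ̄_ℓ`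
coefficients reduce to a finite `E/ℚ_ℓ` by compactness.)  Typed here only to CERTIFY in the kernel that PAR is implied by S together with it
(`par_of_langlands`); it is a theorem in print, not a crux. -/
def PowerCharpolyPotentialEquivalence : Prop :=
  ∀ (K : Type) [Field K] [NumberField K] (n ℓ : ℕ) [Fact ℓ.Prime] (ρ₁ ρ₂ : Literature.NumberTheory.GaloisRepresentations.FramedGaloisRep K (PadicAlgCl ℓ) n), ρ₁.toGaloisRep.IsSemisimple → ρ₂.toGaloisRep.IsSemisimple → ∀ (m : ℕ), 0 < m → (∀ᶠ v : IsDedekindDomain.HeightOneSpectrum (NumberField.RingOfIntegers K) in cofinite, ρ₁.IsUnramifiedAt v ∧ ρ₂.IsUnramifiedAt v ∧ ∀ 𝔓 ∈ v.primesAbove, ∀ σ : Field.absoluteGaloisGroup K, IsArithFrobAt (NumberField.RingOfIntegers K) σ 𝔓 → Literature.NumberTheory.GaloisRepresentations.FramedRep.charpoly ρ₁ (σ ^ m) = Literature.NumberTheory.GaloisRepresentations.FramedRep.charpoly ρ₂ (σ ^ m)) → ∃ (M : Type) (_ : Field M) (_ : NumberField M) (_ : Algebra K M), IsGalois K M ∧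 ∃ P : GL (Fin n) (PadicAlgCl ℓ), Literature.NumberTheory.GaloisRepresentations.FramedRep.conj P (ρ₁.restrictField M) = ρ₂.restrictField M

/-- **THE PHASE ARGUMENT (core of `par_of_langlands`, 0 sorry).**  If `π` HAS a semisimple avatar `ρ`, then `ρ` is an `e`-power avatar too
(`charpoly_pow_of_hasFrobCharpolyAt`), so `ρ` and the candidate `ρ₀` have the same `e`-th power Frobenius polynomials a.e.; by [PR] they are
conjugate on some finite Galois layer `Γ_M`, on which `ρ₀` is irreducible (strong irreducibility), so Schur–Clifford (tree
`FramedGaloisRep.exists_twist_of_conj_restrictField`) gives `P ρ P⁻¹ = ρ₀ ⊗ χ` for a character `χ` of `Gal(M/K)`; compatibility is invariant under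
change of frame (`satakeFrobCompatibleAt_conj_iff`).  Hence PAR is WEAKER than S modulo a 2010 theorem, and says nothing about direction (B). -/
theorem par_core (hPR : PowerCharpolyPotentialEquivalence) {K : Type} [Field K] [NumberField K] {n : ℕ} {hcpt : isCompact_glFiniteIntegralLevel n K}
    (π : AutomorphicRepData (AutomorphyDatum.gl n K hcpt)) {ℓ : ℕ} [Fact ℓ.Prime] (ι : PadicAlgCl ℓ ≃+* ℂ) {ρ ρ₀ : FramedGaloisRep K (PadicAlgCl ℓ) n}
    (hss : ρ.toGaloisRep.IsSemisimple) (hc : ∀ᶠ v : HeightOneSpectrum (𝓞 K) in cofinite, SatakeFrobCompatibleAt ι π ρ v)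
    (hρ₀ : ρ₀.toGaloisRep.IsSemisimple) (hstrong : ∀ (M : Type) [Field M] [NumberField M] [Algebra K M], (ρ₀.restrictField M).IsIrreducible)
    {e : ℕ} (he : 0 < e)
    (hpow : ∀ᶠ v : HeightOneSpectrum (𝓞 K) in cofinite, ∀ α : Multiset ℂ, π.HasSatakeParamAt v α → ρ₀.IsUnramifiedAt v ∧
      ∀ 𝔓 ∈ v.primesAbove, ∀ σ : Field.absoluteGaloisGroup K, IsArithFrobAt (𝓞 K) σ 𝔓 →
        FramedRep.charpoly ρ₀ (σ ^ e) = arithFrobPolyOfSatake ι (v.residueCard ^ e) 1 (α.map (fun a => a ^ e))) :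
    ∃ χ : Field.absoluteGaloisGroup K →ₜ* (PadicAlgCl ℓ)ˣ, ∀ᶠ v : HeightOneSpectrum (𝓞 K) in cofinite, SatakeFrobCompatibleAt ι π (FramedRep.twist ρ₀ χ) v := by
  haveI : IsAlgClosed (PadicAlgCl ℓ) := AlgebraicClosure.isAlgClosed _
  have hagree : ∀ᶠ v : HeightOneSpectrum (𝓞 K) in cofinite, ρ.IsUnramifiedAt v ∧ ρ₀.IsUnramifiedAt v ∧
      ∀ 𝔓 ∈ v.primesAbove, ∀ σ : Field.absoluteGaloisGroup K, IsArithFrobAt (𝓞 K) σ 𝔓 →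
        FramedRep.charpoly ρ (σ ^ e) = FramedRep.charpoly ρ₀ (σ ^ e) := by
    filter_upwards [hpow, hc] with v hv hv'
    obtain ⟨α, hα, hur, hch⟩ := hv'
    obtain ⟨hur₀, hch₀⟩ := hv α hα
    refine ⟨hur, hur₀, fun 𝔓 h𝔓 σ hσ => ?_⟩
    rw [hch₀ 𝔓 h𝔓 σ hσ]
    exact charpoly_pow_of_hasFrobCharpolyAt ι hch h𝔓 hσ e
  obtain ⟨M, _i1, _i2, _i3, hGalM, P, hP⟩ := hPR K n ℓ ρ ρ₀ hss hρ₀ e he hagree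
  haveI : IsGalois K M := hGalM
  obtain ⟨χ, P', -, hP'⟩ := FramedGaloisRep.exists_twist_of_conj_restrictField (M := M) ρ ρ₀ (hstrong M) ⟨P, hP⟩
  refine ⟨χ, ?_⟩
  have e1 : (FramedRep.twist ρ₀ χ : FramedGaloisRep K (PadicAlgCl ℓ) n) = FramedRep.conj P' ρ := hP'.symm
  rw [e1]
  exact hc.mono fun v hv => (satakeFrobCompatibleAt_conj_iff π ι P' ρ v).2 hv

/-- **S ∧ [PR] ⟹ PAR** (0 sorry): the avatar is the summit's `ρ_{π,ι}` (irreducible, hence semisimple). -/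
theorem par_of_langlands (hPR : PowerCharpolyPotentialEquivalence) (hL : _root_.Langlands) : PowerAvatarDescent := by
  intro K _ _ n hcpt hn π hπ ℓ _ ι ρ₀ hρ₀ hstrong e he hpow
  obtain ⟨⟨Rec⟩, h⟩ := hL K
  obtain ⟨ρ, hirr, -, hcorr, -⟩ := (h Rec n hn hcpt).1 π hπ ℓ ι
  have hss : ρ.toGaloisRep.IsSemisimple := by
    haveI : ρ.toGaloisRep.toRepresentation.IsIrreducible := hirr
    change ComplementedLattice _
    infer_instance
  exact par_core hPR π.1 ι hss hcorr.1 hρ₀ hstrong he hpow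

/-- **DECIDED REGIME CELL · PAR for regular algebraic `π`, odd `n`, `K` totally real or CM — modulo the two print facts** [HLTT 2016 / Scholze 2015 /
Varma: tree named fact `exists_galoisRep_of_regularAlgebraic`, through the tree's `exists_avatar_of_regularAlgebraic`] and [PR]: there the avatar is
KNOWN, so the phase of every strongly irreducible power avatar is coherent.  PAR is OPEN exactly where avatars are: the irregular / even / general-`K`
regime (NonRegularWeightBarrier, ShimuraVarietyRealizationBarrier) — the same frontier as (A), but asked of a GIVEN Galois representation. -/
theorem par_regularAlgebraic_odd (hPR : PowerCharpolyPotentialEquivalence) (hH : exists_galoisRep_of_regularAlgebraic)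
    {K : Type} [Field K] [NumberField K] (hK : NumberField.IsTotallyReal K ∨ NumberField.IsCMField K) {n : ℕ} (hcpt : isCompact_glFiniteIntegralLevel n K)
    (k : ℕ) (hn : n = 2 * k + 1) (π : CuspidalAutomorphicRepData n K hcpt) (hreg : π.1.IsRegularAlgebraic)
    {ℓ : ℕ} [Fact ℓ.Prime] (ι : PadicAlgCl ℓ ≃+* ℂ) (ρ₀ : FramedGaloisRep K (PadicAlgCl ℓ) n) (hρ₀ : ρ₀.toGaloisRep.IsSemisimple)
    (hstrong : ∀ (M : Type) [Field M] [NumberField M] [Algebra K M], (ρ₀.restrictField M).IsIrreducible) {e : ℕ} (he : 0 < e)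
    (hpow : ∀ᶠ v : HeightOneSpectrum (𝓞 K) in cofinite, ∀ α : Multiset ℂ, π.1.HasSatakeParamAt v α → ρ₀.IsUnramifiedAt v ∧
      ∀ 𝔓 ∈ v.primesAbove, ∀ σ : Field.absoluteGaloisGroup K, IsArithFrobAt (𝓞 K) σ 𝔓 →
        FramedRep.charpoly ρ₀ (σ ^ e) = arithFrobPolyOfSatake ι (v.residueCard ^ e) 1 (α.map (fun a => a ^ e))) :
    ∃ χ : Field.absoluteGaloisGroup K →ₜ* (PadicAlgCl ℓ)ˣ, ∀ᶠ v : HeightOneSpectrum (𝓞 K) in cofinite, SatakeFrobCompatibleAt ι π.1 (FramedRep.twist ρ₀ χ) v := by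
  obtain ⟨ρ, hss, hc⟩ := exists_avatar_of_regularAlgebraic hH hcpt hK k hn π hreg ι
  exact par_core hPR π.1 ι hss hc hρ₀ hstrong he hpow

/-! ## §4 Host corollaries BY NAME (through the tree's `SchurObstructionExit.closes_host` / `closes_parent` / `closes_grandparent`) -/

/-- With the other items of the queued PerfectLayerClifford kit (FINTYPE, RED°) and of its layer-2 child SchurTorsionExit (W1, SCHT):
`GaloisHullLift.PerfectHullDescent` (RPERF, stmt-Langlands-28225) BY NAME. -/
theorem closes_host (hP : PowerAvatarDescent) (hI : ImprimitiveCandidateRigidity) (hF : FiniteTypePerfectDescent) (hRed : ReduciblePerfectDescent)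
    (hW : LayerDeterminantDescent) (hS : SchurObstructionExit.SchurTorsionLayerExtension) : GaloisHullLift.PerfectHullDescent :=
  SchurObstructionExit.closes_host (closes_target hP hI) hF hRed hW hS

/-- Up one level: `CyclicLayerPeeling.AnabelianLayerDescent` (ANAB, stmt-Langlands-27861). -/
theorem closes_parent (hP : PowerAvatarDescent) (hI : ImprimitiveCandidateRigidity) (hF : FiniteTypePerfectDescent) (hRed : ReduciblePerfectDescent)
    (hW : LayerDeterminantDescent) (hS : SchurObstructionExit.SchurTorsionLayerExtension) (hSt : GaloisHullLift.SelfTwistedHullDescent)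
    (hTr : GaloisHullLift.TrivialHullDescent) (hC : CyclicLayerPeeling.PrimeCyclicLayerDescent) (hBc : CyclicLayerPeeling.CyclicBaseChangeBelow) :
    CyclicLayerPeeling.AnabelianLayerDescent :=
  SchurObstructionExit.closes_parent (closes_target hP hI) hF hRed hW hS hSt hTr hC hBc

/-- Up two levels: `RootDecomp1.AvatarDescent` (stmt-Langlands-29149). -/
theorem closes_grandparent (hP : PowerAvatarDescent) (hI : ImprimitiveCandidateRigidity) (hF : FiniteTypePerfectDescent) (hRed : ReduciblePerfectDescent)
    (hW : LayerDeterminantDescent) (hS : SchurObstructionExit.SchurTorsionLayerExtension) (hSt : GaloisHullLift.SelfTwistedHullDescent)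
    (hTr : GaloisHullLift.TrivialHullDescent) (hC : CyclicLayerPeeling.PrimeCyclicLayerDescent) (hBc : CyclicLayerPeeling.CyclicBaseChangeBelow)
    (hS' : CyclicLayerPeeling.SelfTwistedLayerDescent) : RootDecomp1.AvatarDescent :=
  SchurObstructionExit.closes_grandparent (closes_target hP hI) hF hRed hW hS hSt hTr hC hBc hS'

/-! ## §5 The live route item BY NAME (route-Langlands-PerfectLayerClifford rev 0, born 2026-08-31T12:44Z; RIGID = stmt-Langlands-27355) -/

/-- The route item `Theses.PerfectLayerClifford.PerfectLayerRigidity` (stmt-Langlands-27355) and the tree twin `TatePhantomLift.PerfectLayerRigidity`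
are ONE statement (identical text, sha12 `6f5d782b2b84`). -/
theorem rigid_item_iff : Summit.Langlands.Langlands.Theses.PerfectLayerClifford.PerfectLayerRigidity ↔ PerfectLayerRigidity := Iff.rfl

/-- **`closes_item` — the live ledger item stmt-Langlands-27355 BY NAME**: PAR → IMP → `Theses.PerfectLayerClifford.PerfectLayerRigidity`. -/
theorem closes_item (hP : PowerAvatarDescent) (hI : ImprimitiveCandidateRigidity) :
    Summit.Langlands.Langlands.Theses.PerfectLayerClifford.PerfectLayerRigidity :=
  rigid_item_iff.2 (closes_target hP hI)

/-- With the route's other items EXT (27354), FINTYPE (27356), RED° (27357), the ROUTE'S OWN deciding theorem gives the host leaf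
`GaloisHullLift.PerfectHullDescent` (28225): PAR ∧ IMP can REPLACE the binder RIGID of `Theses.PerfectLayerClifford.closes`. -/
theorem closes_route (hE : Summit.Langlands.Langlands.Theses.PerfectLayerClifford.PerfectLayerExtension) (hP : PowerAvatarDescent)
    (hI : ImprimitiveCandidateRigidity) (hF : Summit.Langlands.Langlands.Theses.PerfectLayerClifford.FiniteTypePerfectDescent)
    (hD : Summit.Langlands.Langlands.Theses.PerfectLayerClifford.ReduciblePerfectDescent) : GaloisHullLift.PerfectHullDescent :=
  Summit.Langlands.Langlands.Theses.PerfectLayerClifford.closes hE (closes_item hP hI) hF hD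
end Summit.Langlands.Langlands.Theorems.PhaseTwistSplit
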